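import Summits.Ventures.HodgeRepro2.T5SU11KernelIntegralsEdge
import Summits.Ventures.HodgeRepro2.T5SU11KernelResolventIdentity

/-!
# The kernel resolvent identity at the spectral edge: `(μ + 1) ∫ K_λ(t,r) K_1(r,s) sinh 2r dr = K_λ(t,s) − K_1(t,s)`

Row 511's computation with the second parameter at the bottom of the spectrum, `λ₂ = 1` (`μ₁ = 1·(1 − 2) = −1`,
the kernel `K_1(t, s) = −Ξ(min(t,s)) χ_1(max(t,s))` of the edge resolvent `(L + 1)⁻¹`, rows 480–481): for `t ≤ s`
the integral splits at `t` and `s` into the three Lagrange integrals (rows 510 and 515), and the two Wronskians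
`sinh 2t (φ_λ χ_λ′ − φ_λ′ χ_λ)(t) = −1`, `sinh 2s (Ξ χ_1′ − Ξ′ χ_1)(s) = −1` reduce the right-hand side to
`Ξ(t) χ_1(s) − φ_λ(t) χ_λ(s) = K_λ(t,s) − K_1(t,s)`; the case `t > s` follows by the symmetry of the kernels from the
mirror identity with the parameters in the order `(1, λ)`:

* **`kernel_resolvent_identity_edge`** — `(μ − μ₁) ∫_{(0,∞)} K_λ(t,r) K_1(r,s) sinh 2r dr = K_λ(t,s) − K_1(t,s)` for
  all `t, s > 0`, `λ > 1`;
* **`kernel_resolvent_identity_edge'`** — `(μ₁ − μ) ∫_{(0,∞)} K_1(t,r) K_λ(r,s) sinh 2r dr = K_1(t,s) − K_λ(t,s)`;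
* `kernel_comp_edge_eq` — `∫_{(0,∞)} K_λ(t,r) K_1(r,s) sinh 2r dr = (K_λ(t,s) − K_1(t,s))/(μ + 1)`: the kernel of
  `(L − μ)⁻¹ (L + 1)⁻¹`, and `sphGreenKernel_one_le` — `K_1(t, s) ≤ K_λ(t, s) ≤ 0`: the edge kernel is the smallest
  Green's kernel.

Nothing is claimed about (N).

Blind lane: Mathlib + the HodgeRepro2 prefix only; no sorry; axioms ⊆ {propext, Classical.choice,
Quot.sound}.
-/

namespace Summit.Ventures.HodgeRepro2.T5SU11KernelResolventIdentityEdge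

open Filter Topology MeasureTheory intervalIntegral
open Set (Ioi Ioc Icc)
open T5SU11Cartan T5SU11SphericalFunction T5SU11SphericalBounds T5SU11SphericalContinuous
  T5SU11SphericalSolutionSpaceAll T5SU11SphericalDecay T5SU11RadialGreenKernel T5SU11RadialGreenPositivity T5SU11KernelBracket
  T5SU11SphericalDecayEdge T5SU11KernelBracketEdge T5SU11KernelIntegralsEdge T5SU11KernelResolventIdentity

section measure

variable [MeasurableSpace Circle] [BorelSpace Circle]

variable {lam : ℝ} (hlam : 1 < lam)

include hlam in
/-- **The edge identity for `t ≤ s`, parameters `(λ, 1)`.** -/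
theorem kernel_resolvent_identity_edge_of_le {t s : ℝ} (ht : 0 < t) (hts : t ≤ s) :
    (lam * (lam - 2) - 1 * (1 - 2))
        * ∫ r in Ioi 0, sphGreenKernel lam t r * sphGreenKernel 1 r s * Real.sinh (2 * r)
      = sphGreenKernel lam t s - sphGreenKernel 1 t s := by
  have hs : 0 < s := lt_of_lt_of_le ht hts
  set F : ℝ → ℝ := fun r => sphGreenKernel lam t r * sphGreenKernel 1 r s * Real.sinh (2 * r) with hF
  have e1 : Set.EqOn F (fun r => sphDecay lam t * sphDecay 1 s
      * (sph lam (hyp r) * sph 1 (hyp r) * Real.sinh (2 * r))) (Ioc 0 t) := by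
    intro r hr
    simp only [hF, sphGreenKernel]
    rw [greenKernel_of_le _ _ hr.2, greenKernel_of_ge _ _ (le_trans hr.2 hts)]
    ring
  have e2 : Set.EqOn F (fun r => sph lam (hyp t) * sphDecay 1 s
      * (sphDecay lam r * sph 1 (hyp r) * Real.sinh (2 * r))) (Ioc t s) := by
    intro r hr
    simp only [hF, sphGreenKernel]
    rw [greenKernel_of_ge _ _ hr.1.le, greenKernel_of_ge _ _ hr.2]
    ring
  have e3 : Set.EqOn F (fun r => sph lam (hyp t) * sph 1 (hyp s)
      * (sphDecay lam r * sphDecay 1 r * Real.sinh (2 * r))) (Ioi s) := by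
    intro r hr
    have hr' : s < r := hr
    simp only [hF, sphGreenKernel]
    rw [greenKernel_of_ge _ _ (le_trans hts hr'.le), greenKernel_of_le _ _ hr'.le]
    ring
  have hχ : ContinuousOn (sphDecay lam) (Ioi 0) :=
    fun _ hr => (hasDerivAt_sphDecay hlam hr).continuousAt.continuousWithinAt
  have hI1 : IntegrableOn F (Ioc 0 t) := by
    refine IntegrableOn.congr_fun ?_ e1.symm measurableSet_Ioc
    exact Continuous.integrableOn_Ioc (continuous_const.mul (((continuous_sph_hyp lam).mul
      (continuous_sph_hyp 1)).mul (Real.continuous_sinh.comp (continuous_const.mul continuous_id))))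
  have hI2 : IntegrableOn F (Ioc t s) := by
    refine IntegrableOn.congr_fun ?_ e2.symm measurableSet_Ioc
    have hc : ContinuousOn (fun r => sph lam (hyp t) * sphDecay 1 s
        * (sphDecay lam r * sph 1 (hyp r) * Real.sinh (2 * r))) (Icc t s) :=
      (continuousOn_const.mul (((hχ.mono (fun r hr => lt_of_lt_of_le ht hr.1)).mul
        (continuous_sph_hyp 1).continuousOn).mul
        (Real.continuous_sinh.comp (continuous_const.mul continuous_id)).continuousOn))
    exact hc.integrableOn_Icc.mono_set Set.Ioc_subset_Icc_self
  have hI3 : IntegrableOn F (Ioi s) := by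
    refine IntegrableOn.congr_fun ?_ e3.symm measurableSet_Ioi
    exact (integrableOn_sphDecay_mul_sphDecay_one_mul_sinh hlam hs).const_mul _
  have hsplit1 : Ioc 0 s ∪ Ioi s = Ioi 0 := Set.Ioc_union_Ioi_eq_Ioi hs.le
  have hsplit2 : Ioc 0 t ∪ Ioc t s = Ioc 0 s := Set.Ioc_union_Ioc_eq_Ioc ht.le hts
  have hd1 : Disjoint (Ioc 0 s) (Ioi s) := Set.Ioc_disjoint_Ioi le_rfl
  have hd2 : Disjoint (Ioc 0 t) (Ioc t s) := Set.Ioc_disjoint_Ioc_of_le le_rfl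
  have hI12 : IntegrableOn F (Ioc 0 s) := by
    rw [← hsplit2]; exact hI1.union hI2
  have hint : ∫ r in Ioi 0, F r = (∫ r in Ioc 0 t, F r) + (∫ r in Ioc t s, F r) + ∫ r in Ioi s, F r := by
    rw [← hsplit1, setIntegral_union hd1 measurableSet_Ioi hI12 hI3, ← hsplit2,
      setIntegral_union hd2 measurableSet_Ioc hI1 hI2]
  have h1 := integral_sph_mul_sph lam 1 ht.le
  have h2 := integral_sphDecay_mul_sph hlam 1 ht hts
  have h3 := integral_sphDecay_mul_sphDecay_one_Ioi hlam hs
  have p1 : ∫ r in Ioc 0 t, F r = sphDecay lam t * sphDecay 1 s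
      * ∫ r in (0 : ℝ)..t, sph lam (hyp r) * sph 1 (hyp r) * Real.sinh (2 * r) := by
    rw [setIntegral_congr_fun measurableSet_Ioc e1, MeasureTheory.integral_const_mul, integral_of_le ht.le]
  have p2 : ∫ r in Ioc t s, F r = sph lam (hyp t) * sphDecay 1 s
      * ∫ r in t..s, sphDecay lam r * sph 1 (hyp r) * Real.sinh (2 * r) := by
    rw [setIntegral_congr_fun measurableSet_Ioc e2, MeasureTheory.integral_const_mul, integral_of_le hts]
  have p3 : ∫ r in Ioi s, F r = sph lam (hyp t) * sph 1 (hyp s)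
      * ∫ r in Ioi s, sphDecay lam r * sphDecay 1 r * Real.sinh (2 * r) := by
    rw [setIntegral_congr_fun measurableSet_Ioi e3, MeasureTheory.integral_const_mul]
  have hwt := wronskian_sphDecay hlam ht
  have hws := wronskian_sphDecay_one hs
  show (lam * (lam - 2) - 1 * (1 - 2)) * ∫ r in Ioi 0, F r = _
  rw [hint, p1, p2, p3, sphGreenKernel, sphGreenKernel, greenKernel_of_ge _ _ hts, greenKernel_of_ge _ _ hts]
  linear_combination (sphDecay lam t * sphDecay 1 s) * h1 + (sph lam (hyp t) * sphDecay 1 s) * h2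
    + (sph lam (hyp t) * sph 1 (hyp s)) * h3 - (sphDecay 1 s * sph 1 (hyp t)) * hwt
    + (sph lam (hyp t) * sphDecay lam s) * hws

include hlam in
/-- **The edge identity for `t ≤ s`, parameters `(1, λ)`.** -/
theorem kernel_resolvent_identity_edge_of_le' {t s : ℝ} (ht : 0 < t) (hts : t ≤ s) :
    (1 * (1 - 2) - lam * (lam - 2))
        * ∫ r in Ioi 0, sphGreenKernel 1 t r * sphGreenKernel lam r s * Real.sinh (2 * r)
      = sphGreenKernel 1 t s - sphGreenKernel lam t s := by
  have hs : 0 < s := lt_of_lt_of_le ht hts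
  set F : ℝ → ℝ := fun r => sphGreenKernel 1 t r * sphGreenKernel lam r s * Real.sinh (2 * r) with hF
  have e1 : Set.EqOn F (fun r => sphDecay 1 t * sphDecay lam s
      * (sph 1 (hyp r) * sph lam (hyp r) * Real.sinh (2 * r))) (Ioc 0 t) := by
    intro r hr
    simp only [hF, sphGreenKernel]
    rw [greenKernel_of_le _ _ hr.2, greenKernel_of_ge _ _ (le_trans hr.2 hts)]
    ring
  have e2 : Set.EqOn F (fun r => sph 1 (hyp t) * sphDecay lam s
      * (sphDecay 1 r * sph lam (hyp r) * Real.sinh (2 * r))) (Ioc t s) := by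
    intro r hr
    simp only [hF, sphGreenKernel]
    rw [greenKernel_of_ge _ _ hr.1.le, greenKernel_of_ge _ _ hr.2]
    ring
  have e3 : Set.EqOn F (fun r => sph 1 (hyp t) * sph lam (hyp s)
      * (sphDecay 1 r * sphDecay lam r * Real.sinh (2 * r))) (Ioi s) := by
    intro r hr
    have hr' : s < r := hr
    simp only [hF, sphGreenKernel]
    rw [greenKernel_of_ge _ _ (le_trans hts hr'.le), greenKernel_of_le _ _ hr'.le]
    ring
  have hχ₁ : ContinuousOn (sphDecay 1) (Ioi 0) :=
    fun _ hr => (hasDerivAt_sphDecay_one hr).continuousAt.continuousWithinAt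
  have hI1 : IntegrableOn F (Ioc 0 t) := by
    refine IntegrableOn.congr_fun ?_ e1.symm measurableSet_Ioc
    exact Continuous.integrableOn_Ioc (continuous_const.mul (((continuous_sph_hyp 1).mul
      (continuous_sph_hyp lam)).mul (Real.continuous_sinh.comp (continuous_const.mul continuous_id))))
  have hI2 : IntegrableOn F (Ioc t s) := by
    refine IntegrableOn.congr_fun ?_ e2.symm measurableSet_Ioc
    have hc : ContinuousOn (fun r => sph 1 (hyp t) * sphDecay lam s
        * (sphDecay 1 r * sph lam (hyp r) * Real.sinh (2 * r))) (Icc t s) :=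
      (continuousOn_const.mul (((hχ₁.mono (fun r hr => lt_of_lt_of_le ht hr.1)).mul
        (continuous_sph_hyp lam).continuousOn).mul
        (Real.continuous_sinh.comp (continuous_const.mul continuous_id)).continuousOn))
    exact hc.integrableOn_Icc.mono_set Set.Ioc_subset_Icc_self
  have hI3 : IntegrableOn F (Ioi s) := by
    refine IntegrableOn.congr_fun ?_ e3.symm measurableSet_Ioi
    have := (integrableOn_sphDecay_mul_sphDecay_one_mul_sinh hlam hs).const_mul (sph 1 (hyp t) * sph lam (hyp s))
    refine IntegrableOn.congr_fun this ?_ measurableSet_Ioi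
    intro r _
    simp only
    ring
  have hsplit1 : Ioc 0 s ∪ Ioi s = Ioi 0 := Set.Ioc_union_Ioi_eq_Ioi hs.le
  have hsplit2 : Ioc 0 t ∪ Ioc t s = Ioc 0 s := Set.Ioc_union_Ioc_eq_Ioc ht.le hts
  have hd1 : Disjoint (Ioc 0 s) (Ioi s) := Set.Ioc_disjoint_Ioi le_rfl
  have hd2 : Disjoint (Ioc 0 t) (Ioc t s) := Set.Ioc_disjoint_Ioc_of_le le_rfl
  have hI12 : IntegrableOn F (Ioc 0 s) := by
    rw [← hsplit2]; exact hI1.union hI2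
  have hint : ∫ r in Ioi 0, F r = (∫ r in Ioc 0 t, F r) + (∫ r in Ioc t s, F r) + ∫ r in Ioi s, F r := by
    rw [← hsplit1, setIntegral_union hd1 measurableSet_Ioi hI12 hI3, ← hsplit2,
      setIntegral_union hd2 measurableSet_Ioc hI1 hI2]
  have h1 := integral_sph_mul_sph 1 lam ht.le
  have h2 := integral_sphDecay_one_mul_sph lam ht hts
  have h3 := integral_sphDecay_one_mul_sphDecay_Ioi hlam hs
  have p1 : ∫ r in Ioc 0 t, F r = sphDecay 1 t * sphDecay lam s
      * ∫ r in (0 : ℝ)..t, sph 1 (hyp r) * sph lam (hyp r) * Real.sinh (2 * r) := by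
    rw [setIntegral_congr_fun measurableSet_Ioc e1, MeasureTheory.integral_const_mul, integral_of_le ht.le]
  have p2 : ∫ r in Ioc t s, F r = sph 1 (hyp t) * sphDecay lam s
      * ∫ r in t..s, sphDecay 1 r * sph lam (hyp r) * Real.sinh (2 * r) := by
    rw [setIntegral_congr_fun measurableSet_Ioc e2, MeasureTheory.integral_const_mul, integral_of_le hts]
  have p3 : ∫ r in Ioi s, F r = sph 1 (hyp t) * sph lam (hyp s)
      * ∫ r in Ioi s, sphDecay 1 r * sphDecay lam r * Real.sinh (2 * r) := by
    rw [setIntegral_congr_fun measurableSet_Ioi e3, MeasureTheory.integral_const_mul]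
  have hwt := wronskian_sphDecay_one ht
  have hws := wronskian_sphDecay hlam hs
  show (1 * (1 - 2) - lam * (lam - 2)) * ∫ r in Ioi 0, F r = _
  rw [hint, p1, p2, p3, sphGreenKernel, sphGreenKernel, greenKernel_of_ge _ _ hts, greenKernel_of_ge _ _ hts]
  linear_combination (sphDecay 1 t * sphDecay lam s) * h1 + (sph 1 (hyp t) * sphDecay lam s) * h2
    + (sph 1 (hyp t) * sph lam (hyp s)) * h3 - (sphDecay lam s * sph lam (hyp t)) * hwt
    + (sph 1 (hyp t) * sphDecay 1 s) * hws

include hlam in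
/-- **THE KERNEL RESOLVENT IDENTITY AT THE EDGE**: `(μ − μ₁) ∫_{(0,∞)} K_λ(t,r) K_1(r,s) sinh 2r dr = K_λ(t,s) − K_1(t,s)`
for all `t, s > 0`, `μ₁ = 1·(1 − 2) = −1`. -/
theorem kernel_resolvent_identity_edge {t s : ℝ} (ht : 0 < t) (hs : 0 < s) :
    (lam * (lam - 2) - 1 * (1 - 2))
        * ∫ r in Ioi 0, sphGreenKernel lam t r * sphGreenKernel 1 r s * Real.sinh (2 * r)
      = sphGreenKernel lam t s - sphGreenKernel 1 t s := by
  rcases le_or_gt t s with hts | hst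
  · exact kernel_resolvent_identity_edge_of_le hlam ht hts
  · have h := kernel_resolvent_identity_edge_of_le' hlam hs hst.le
    have e : ∫ r in Ioi 0, sphGreenKernel lam t r * sphGreenKernel 1 r s * Real.sinh (2 * r)
        = ∫ r in Ioi 0, sphGreenKernel 1 s r * sphGreenKernel lam r t * Real.sinh (2 * r) := by
      apply MeasureTheory.integral_congr_ae
      refine Eventually.of_forall fun r => ?_
      simp only
      rw [sphGreenKernel_symm lam t r, sphGreenKernel_symm 1 r s]
      ring
    rw [e, sphGreenKernel_symm lam t s, sphGreenKernel_symm 1 t s]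
    linear_combination -h

include hlam in
/-- The mirror: `(μ₁ − μ) ∫_{(0,∞)} K_1(t,r) K_λ(r,s) sinh 2r dr = K_1(t,s) − K_λ(t,s)` for all `t, s > 0`. -/
theorem kernel_resolvent_identity_edge' {t s : ℝ} (ht : 0 < t) (hs : 0 < s) :
    (1 * (1 - 2) - lam * (lam - 2))
        * ∫ r in Ioi 0, sphGreenKernel 1 t r * sphGreenKernel lam r s * Real.sinh (2 * r)
      = sphGreenKernel 1 t s - sphGreenKernel lam t s := by
  rcases le_or_gt t s with hts | hst
  · exact kernel_resolvent_identity_edge_of_le' hlam ht hts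
  · have h := kernel_resolvent_identity_edge_of_le hlam hs hst.le
    have e : ∫ r in Ioi 0, sphGreenKernel 1 t r * sphGreenKernel lam r s * Real.sinh (2 * r)
        = ∫ r in Ioi 0, sphGreenKernel lam s r * sphGreenKernel 1 r t * Real.sinh (2 * r) := by
      apply MeasureTheory.integral_congr_ae
      refine Eventually.of_forall fun r => ?_
      simp only
      rw [sphGreenKernel_symm 1 t r, sphGreenKernel_symm lam r s]
      ring
    rw [e, sphGreenKernel_symm 1 t s, sphGreenKernel_symm lam t s]
    linear_combination -h

include hlam in
/-- **The kernel of `(L − μ)⁻¹ (L + 1)⁻¹`**: `∫_{(0,∞)} K_λ(t,r) K_1(r,s) sinh 2r dr = (K_λ(t,s) − K_1(t,s))/(μ + 1)`. -/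
theorem kernel_comp_edge_eq {t s : ℝ} (ht : 0 < t) (hs : 0 < s) :
    ∫ r in Ioi 0, sphGreenKernel lam t r * sphGreenKernel 1 r s * Real.sinh (2 * r)
      = (sphGreenKernel lam t s - sphGreenKernel 1 t s) / (lam * (lam - 2) + 1) := by
  have hκ : lam * (lam - 2) + 1 ≠ 0 := by nlinarith
  rw [eq_div_iff hκ, mul_comm]
  have := kernel_resolvent_identity_edge hlam ht hs
  linear_combination this

include hlam in
/-- The composed kernel with the edge kernel is nonnegative. -/
theorem kernel_comp_edge_nonneg {t : ℝ} (ht : 0 < t) (s : ℝ) :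
    0 ≤ ∫ r in Ioi 0, sphGreenKernel lam t r * sphGreenKernel 1 r s * Real.sinh (2 * r) := by
  apply setIntegral_nonneg measurableSet_Ioi
  intro r hr
  have hr0 : 0 < r := hr
  have h1 : sphGreenKernel lam t r ≤ 0 := (sphGreenKernel_neg hlam ht).le
  have h2 : sphGreenKernel 1 r s ≤ 0 := by
    unfold sphGreenKernel greenKernel
    have ha := sph_hyp_pos 1 (min r s)
    have hb := sphDecay_one_pos (lt_of_lt_of_le hr0 (le_max_left r s))
    nlinarith
  exact mul_nonneg (mul_nonneg_of_nonpos_of_nonpos h1 h2) (Real.sinh_nonneg_iff.mpr (by linarith))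

include hlam in
/-- **The edge kernel is the smallest Green's kernel**: `K_1(t, s) ≤ K_λ(t, s)` for every `λ > 1`. -/
theorem sphGreenKernel_one_le {t s : ℝ} (ht : 0 < t) (hs : 0 < s) :
    sphGreenKernel 1 t s ≤ sphGreenKernel lam t s := by
  have h := kernel_resolvent_identity_edge hlam ht hs
  have hκ : 0 ≤ lam * (lam - 2) - 1 * (1 - 2) := by nlinarith
  have := mul_nonneg hκ (kernel_comp_edge_nonneg hlam ht s)
  linarith

end measure

end Summit.Ventures.HodgeRepro2.T5SU11KernelResolventIdentityEdge
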